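import Literature.Barriers.CriticalPhenomena.GaussianDominationRouteLaceExpansionCuttingBond
import HarnessLib

/-!
# Towards `HaraSlade1990_infraredBound_holds`, XV: Prop. 6.1, the inclusion–exclusion lace
# expansion — `HvdH2017_prop61` DISCHARGED

Sibling proof file of `GaussianDominationRouteLaceExpansion.lean` (barrier catalogue
`Literature/Barriers/CriticalPhenomena/`), last of the four files
(`…Pivotal`, `…Toggle`, `…CuttingBond`, this one) proving Heydenreich–van der Hofstad 2017,
Prop. 6.1: for `p < p_c`, `d ≥ 2` and every `M`,

  `τ(x) = δ_{0,x} + (J⋆τ)(x) + (Π_M⋆J⋆τ)(x) + Π_M(x) + R_M(x)`.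

The book proves it by iterating (6.2.24) inside the nested expectations ("and so on",
Exercise 6.5). Here the iteration is the following algebra on `[0,∞]`-valued kernels: the
one-step identity `kerThrough + 𝒩 kerThrough = kerE + 𝒯 kerE` of `…CuttingBond.lean`, the
ADDITIVITY of the nesting operator `𝒩` (`nestOp_add`) and the commutation `𝒩𝒯 = 𝒯𝒩`
(`nestOp_transOp`, `…Remainder.lean`) give, for `Tₙ = 𝒩ⁿ kerThrough`, `Eₙ = 𝒩ⁿ kerE = Π̃^{(n)}`,

  `Tₙ + Tₙ₊₁ = Eₙ + 𝒯Eₙ`  (`nestIter_kerThrough_add`),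

all finite at `(ℤ^d, 0, x)` below `p_c`; the alternating sum over `n ≤ M` telescopes to
`T₀ = Σₙ(-1)ⁿEₙ + Σₙ(-1)ⁿ𝒯Eₙ + (-1)^{M+1}T_{M+1}` (`toReal_kerThrough_eq_alternating`), and
`T₀ = τ(x)`, `(-1)^{M+1}T_{M+1} = R_M(x)`, `Σₙ(-1)ⁿEₙ = Π_M + δ_0`
(`sum_neg_one_pow_mul_lacePiT_toReal`), `Σₙ(-1)ⁿ𝒯Eₙ = Π_M⋆(J⋆τ) + J⋆τ`
(`sum_neg_one_pow_mul_latticeConv_lacePiT`) — which is (6.2.2): `HvdH2017_prop61_holds`.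

## References

* M. Heydenreich, R. van der Hofstad, *Progress in High-Dimensional Percolation and Random
  Graphs* (Springer 2017): Prop. 6.1 ((6.2.2)–(6.2.3)), (6.2.18)–(6.2.28), Exercises 6.4–6.5.
* G. Slade, *The Lace Expansion and its Applications* (LNM 1879, 2006): Thm. 10.2 / (10.2),
  (10.19)–(10.29).
* T. Hara, G. Slade, Comm. Math. Phys. 128 (1990) 333–391, Prop. 2.3.
-/

noncomputable section

namespace Literature.Barriers.CriticalPhenomena

open _root_.MeasureTheory Literature.Probability.LatticeModels Literature.Probability.Percolation
open SpreadOutIsing (delta0 latticeConv)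
open scoped ENNReal

variable {d : ℕ}

/-! ### Additivity of the nesting operator and the iterated identity -/

/-- **The nesting operator is additive**: `𝒩(h₁ + h₂) = 𝒩h₁ + 𝒩h₂` (for `h₁` measurable in the set
variable; linearity of the expectation). [cite: HeydenreichVanDerHofstad2017, (6.2.24)–(6.2.26)] -/
theorem nestOp_add (p : unitInterval) {h₁ h₂ : LaceKernel d} (hh₁ : KernelMeasurable h₁)
    (A : Set (Site d)) (v x : Site d) :
    nestOp d p (h₁ + h₂) A v x = nestOp d p h₁ A v x + nestOp d p h₂ A v x := by
  rw [nestOp_apply, nestOp_apply, nestOp_apply, ← ENNReal.tsum_add]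
  refine tsum_congr fun b => ?_
  rw [← mul_add, ← lintegral_add_left (measurable_nestIntegrand hh₁ A v x b.1 b.2)]
  congr 1
  refine lintegral_congr fun ω => ?_
  by_cases hω : ω ∈ laceE A v b.1
  · simp only [Set.indicator_of_mem hω, Pi.add_apply]
  · simp only [Set.indicator_of_notMem hω, add_zero]

/-- **The iterated expansion identity**: for `p < p_c` and every `n`,
`𝒩ⁿ kerThrough + 𝒩ⁿ⁺¹ kerThrough = 𝒩ⁿ kerE + 𝒯(𝒩ⁿ kerE)` — the `n`-fold nesting of the one-step
identity (6.2.24) ("we now repeat this procedure recursively … and so on", Exercise 6.5).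
[cite: HeydenreichVanDerHofstad2017, (6.2.24)–(6.2.28) and Exercise 6.5] -/
theorem nestIter_kerThrough_add {p : unitInterval} (hp : (p : ℝ) < criticalProb (zdGraph d) (0 : Site d)) :
    ∀ (n : ℕ) (A : Set (Site d)) (v x : Site d),
      nestIter d p (kerThrough d p) n A v x + nestIter d p (kerThrough d p) (n + 1) A v x =
        nestIter d p (kerE d p) n A v x + transOp d p (nestIter d p (kerE d p) n) A v x
  | 0, A, v, x => kerThrough_add_nestOp_kerThrough hp A v x
  | n + 1, A, v, x => by
    have ih : nestIter d p (kerThrough d p) n + nestIter d p (kerThrough d p) (n + 1) =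
        nestIter d p (kerE d p) n + transOp d p (nestIter d p (kerE d p) n) :=
      funext fun A => funext fun v => funext fun x => nestIter_kerThrough_add hp n A v x
    calc nestIter d p (kerThrough d p) (n + 1) A v x + nestIter d p (kerThrough d p) (n + 1 + 1) A v x
        = nestOp d p (nestIter d p (kerThrough d p) n + nestIter d p (kerThrough d p) (n + 1)) A v x := by
          rw [nestOp_add p (nestIter_measurable p (kerThrough_measurable p) n), ← nestIter_succ,
            ← nestIter_succ]
      _ = nestOp d p (nestIter d p (kerE d p) n + transOp d p (nestIter d p (kerE d p) n)) A v x := by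
          rw [ih]
      _ = nestIter d p (kerE d p) (n + 1) A v x + transOp d p (nestIter d p (kerE d p) (n + 1)) A v x := by
          rw [nestOp_add p (nestIter_measurable p (kerE_measurable p) n),
            nestOp_transOp p (nestIter_measurable p (kerE_measurable p) n), ← nestIter_succ]

/-! ### At the origin, in real numbers -/

section Real

variable {p : unitInterval}

/-- `𝒯(𝒩ⁿ kerE)(ℤ^d, 0, x)` is finite below `p_c`, with real value `(Π̃^{(n)} ⋆ (J ⋆ τ))(x)`.
[cite: HeydenreichVanDerHofstad2017, (6.3.2)] -/
theorem transOp_nestIter_kerE_toReal (hd : 2 ≤ d) (hp : (p : ℝ) < criticalProb (zdGraph d) (0 : Site d))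
    (M : ℕ) (x : Site d) :
    transOp d p (nestIter d p (kerE d p) M) Set.univ 0 x ≠ ∞ ∧
      (transOp d p (nestIter d p (kerE d p) M) Set.univ 0 x).toReal =
        latticeConv (fun u => (lacePiT d p M u).toReal) (latticeConv (bondJ d p) (tau d p 0)) x := by
  have hd1 : 1 ≤ d := by omega
  have hJτ0 : ∀ y, 0 ≤ latticeConv (bondJ d p) (tau d p 0) y := fun y =>
    latticeConv_nonneg (bondJ_nonneg p) (fun z => tau_nonneg p 0 z) y
  have hJτle : ∀ y, latticeConv (bondJ d p) (tau d p 0) y ≤ 2 * d * (p : ℝ) := fun y =>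
    latticeConv_bondJ_le hd1 p (fun z => tau_nonneg p 0 z) (fun z => tau_le_one p 0 z) y
  have hBeq := transOp_lacePiT_eq hd1 p M x
  have hB_top : transOp d p (nestIter d p (kerE d p) M) Set.univ 0 x ≠ ∞ := by
    rw [hBeq]
    refine (lt_of_le_of_lt (ENNReal.tsum_le_tsum fun u => mul_le_mul_right
      (ENNReal.ofReal_le_ofReal (hJτle (x - u))) _) ?_).ne
    rw [ENNReal.tsum_mul_right]
    exact ENNReal.mul_lt_top (tsum_lacePiT_lt_top hd p hp M) ENNReal.ofReal_lt_top
  refine ⟨hB_top, ?_⟩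
  rw [hBeq, ENNReal.tsum_toReal_eq fun u => ENNReal.mul_ne_top (lacePiT_ne_top hd p hp M u)
    ENNReal.ofReal_ne_top]
  show (∑' u, (lacePiT d p M u * ENNReal.ofReal (latticeConv (bondJ d p) (tau d p 0) (x - u))).toReal) =
    ∑' u, (lacePiT d p M u).toReal * latticeConv (bondJ d p) (tau d p 0) (x - u)
  exact tsum_congr fun u => by rw [ENNReal.toReal_mul, ENNReal.toReal_ofReal (hJτ0 (x - u))]

/-- `𝒩ⁿ kerThrough (ℤ^d, 0, x)` is finite below `p_c` (`n = 0`: a probability; `n + 1`: the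
remainder bound (6.3.2)). [cite: HeydenreichVanDerHofstad2017, (6.3.2)] -/
theorem nestIter_kerThrough_ne_top (hd : 2 ≤ d) (hp : (p : ℝ) < criticalProb (zdGraph d) (0 : Site d))
    (x : Site d) : ∀ n, nestIter d p (kerThrough d p) n Set.univ 0 x ≠ ∞
  | 0 => by rw [nestIter_zero, kerThrough_apply]; exact measure_ne_top _ _
  | n + 1 => ((nestIter_kerThrough_le_transOp p n Set.univ 0 x).trans_lt
      (lt_top_iff_ne_top.2 (transOp_nestIter_kerE_toReal hd hp n x).1)).ne

/-- The iterated identity at the origin, in real numbers: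
`tₙ + tₙ₊₁ = Π̃^{(n)}(x) + (Π̃^{(n)} ⋆ J ⋆ τ)(x)` with `tₙ = 𝒩ⁿ kerThrough(ℤ^d,0,x)`.
[cite: HeydenreichVanDerHofstad2017, (6.2.24)–(6.2.28)] -/
theorem toReal_nestIter_kerThrough_add (hd : 2 ≤ d) (hp : (p : ℝ) < criticalProb (zdGraph d) (0 : Site d))
    (n : ℕ) (x : Site d) :
    (nestIter d p (kerThrough d p) n Set.univ 0 x).toReal +
        (nestIter d p (kerThrough d p) (n + 1) Set.univ 0 x).toReal =
      (lacePiT d p n x).toReal +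
        latticeConv (fun u => (lacePiT d p n u).toReal) (latticeConv (bondJ d p) (tau d p 0)) x := by
  obtain ⟨htop, hreal⟩ := transOp_nestIter_kerE_toReal hd hp n x
  have he : nestIter d p (kerE d p) n Set.univ 0 x ≠ ∞ := lacePiT_ne_top hd p hp n x
  rw [← hreal, ← ENNReal.toReal_add (nestIter_kerThrough_ne_top hd hp x n)
    (nestIter_kerThrough_ne_top hd hp x (n + 1)), nestIter_kerThrough_add hp n Set.univ 0 x,
    ENNReal.toReal_add he htop]
  rfl

/-- **Telescoping the alternating sum** (the induction of Exercise 6.5): for every `M`,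
`t₀ = Σ_{n ≤ M} (-1)ⁿ Π̃^{(n)}(x) + Σ_{n ≤ M} (-1)ⁿ (Π̃^{(n)} ⋆ J ⋆ τ)(x) + (-1)^{M+1} t_{M+1}`.
[cite: HeydenreichVanDerHofstad2017, Prop. 6.1 (proof) and Exercise 6.5] -/
theorem toReal_kerThrough_eq_alternating (hd : 2 ≤ d) (hp : (p : ℝ) < criticalProb (zdGraph d) (0 : Site d))
    (x : Site d) : ∀ M : ℕ,
    (nestIter d p (kerThrough d p) 0 Set.univ 0 x).toReal =
      ∑ n ∈ Finset.range (M + 1), (-1 : ℝ) ^ n * (lacePiT d p n x).toReal +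
      ∑ n ∈ Finset.range (M + 1), (-1 : ℝ) ^ n *
        latticeConv (fun u => (lacePiT d p n u).toReal) (latticeConv (bondJ d p) (tau d p 0)) x +
      (-1 : ℝ) ^ (M + 1) * (nestIter d p (kerThrough d p) (M + 1) Set.univ 0 x).toReal
  | 0 => by
    have h := toReal_nestIter_kerThrough_add hd hp 0 x
    simp only [Finset.sum_range_one, pow_zero, one_mul, zero_add, pow_one]
    linear_combination h
  | M + 1 => by
    have ih := toReal_kerThrough_eq_alternating hd hp x M
    have h := toReal_nestIter_kerThrough_add hd hp (M + 1) x
    rw [Finset.sum_range_succ _ (M + 1), Finset.sum_range_succ _ (M + 1)]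
    linear_combination ih + (-1 : ℝ) ^ (M + 1) * h

/-- `Σ_{n ≤ M} (-1)ⁿ Π̃^{(n)}(u) = Π_M(u) + δ_{0,u}` (`Π̃^{(0)} = Π^{(0)} + δ_0`, `Π̃^{(n)} = Π^{(n)}`
for `n ≥ 1`). [cite: HeydenreichVanDerHofstad2017, (6.2.3) and (6.2.7)] -/
theorem sum_neg_one_pow_mul_lacePiT_toReal (p : unitInterval) (M : ℕ) (u : Site d) :
    ∑ n ∈ Finset.range (M + 1), (-1 : ℝ) ^ n * (lacePiT d p n u).toReal = lacePiM d p M u + delta0 u := by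
  have h0 : (lacePiT d p 0 u).toReal = lacePi d p 0 u + delta0 u := by
    have hδ : (if 0 = 0 ∧ u = 0 then (1 : ℝ) else 0) = delta0 u := by
      unfold delta0
      exact if_congr (and_iff_right rfl) rfl rfl
    rw [lacePi_def, hδ, sub_add_cancel]
  have hS : ∀ N : ℕ, (lacePiT d p (N + 1) u).toReal = lacePi d p (N + 1) u := fun N =>
    (lacePi_of_ne (Or.inl (Nat.succ_ne_zero N))).symm
  rw [lacePiM_def, Finset.sum_range_succ', Finset.sum_range_succ' fun N => (-1 : ℝ) ^ N * lacePi d p N u]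
  simp only [hS, pow_zero, one_mul, h0]
  ring

/-- `Σ_u δ_{0,u} g(x - u) = g(x)`. [folklore] -/
theorem tsum_delta0_mul (g : Site d → ℝ) (x : Site d) : ∑' u : Site d, delta0 u * g (x - u) = g x := by
  rw [tsum_eq_single 0]
  · simp [delta0]
  · intro u hu
    rw [SpreadOutIsing.delta0_of_ne_zero hu, zero_mul]

/-- `Σ_{n ≤ M} (-1)ⁿ (Π̃^{(n)} ⋆ (J ⋆ τ))(x) = (Π_M ⋆ (J ⋆ τ))(x) + (J ⋆ τ)(x)` (finite sums commute with the
absolutely convergent convolution; `δ_0 ⋆ g = g`). [cite: HeydenreichVanDerHofstad2017, (6.2.2)–(6.2.3)] -/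
theorem sum_neg_one_pow_mul_latticeConv_lacePiT (hd : 2 ≤ d)
    (hp : (p : ℝ) < criticalProb (zdGraph d) (0 : Site d)) (M : ℕ) (x : Site d) :
    ∑ n ∈ Finset.range (M + 1), (-1 : ℝ) ^ n *
        latticeConv (fun u => (lacePiT d p n u).toReal) (latticeConv (bondJ d p) (tau d p 0)) x =
      latticeConv (lacePiM d p M) (latticeConv (bondJ d p) (tau d p 0)) x +
        latticeConv (bondJ d p) (tau d p 0) x := by
  have hd1 : 1 ≤ d := by omega
  set g : Site d → ℝ := latticeConv (bondJ d p) (tau d p 0) with hg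
  have hg0 : ∀ y, 0 ≤ g y := fun y => latticeConv_nonneg (bondJ_nonneg p) (fun z => tau_nonneg p 0 z) y
  have hgle : ∀ y, g y ≤ 2 * d * (p : ℝ) := fun y =>
    latticeConv_bondJ_le hd1 p (fun z => tau_nonneg p 0 z) (fun z => tau_le_one p 0 z) y
  have hsum_e : ∀ n, Summable fun u => (lacePiT d p n u).toReal := fun n =>
    ENNReal.summable_toReal (tsum_lacePiT_lt_top hd p hp n).ne
  have hsum_eg : ∀ n, Summable fun u => (lacePiT d p n u).toReal * g (x - u) := fun n =>
    Summable.of_nonneg_of_le (fun u => mul_nonneg ENNReal.toReal_nonneg (hg0 _))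
      (fun u => mul_le_mul_of_nonneg_left (hgle _) ENNReal.toReal_nonneg) ((hsum_e n).mul_right _)
  -- pointwise: `Σ_n (-1)^n Π̃^{(n)}(u) g(x-u) = (Π_M(u) + δ_0(u)) g(x-u)`
  have hpt : ∀ u, ∑ n ∈ Finset.range (M + 1), (-1 : ℝ) ^ n * ((lacePiT d p n u).toReal * g (x - u)) =
      (lacePiM d p M u + delta0 u) * g (x - u) := by
    intro u
    rw [← sum_neg_one_pow_mul_lacePiT_toReal p M u, Finset.sum_mul]
    exact Finset.sum_congr rfl fun n _ => by ring
  have hS : Summable fun u => ∑ n ∈ Finset.range (M + 1), (-1 : ℝ) ^ n * ((lacePiT d p n u).toReal * g (x - u)) :=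
    summable_sum fun n _ => (hsum_eg n).mul_left _
  have hδ : Summable fun u => delta0 u * g (x - u) := by
    refine summable_of_ne_finset_zero (s := {0}) fun u hu => ?_
    rw [SpreadOutIsing.delta0_of_ne_zero (by simpa using hu), zero_mul]
  have hPiM : Summable fun u => lacePiM d p M u * g (x - u) :=
    (hS.sub hδ).congr fun u => by simp only [hpt u]; ring
  calc ∑ n ∈ Finset.range (M + 1), (-1 : ℝ) ^ n * latticeConv (fun u => (lacePiT d p n u).toReal) g x
      = ∑ n ∈ Finset.range (M + 1), ∑' u, (-1 : ℝ) ^ n * ((lacePiT d p n u).toReal * g (x - u)) := by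
        refine Finset.sum_congr rfl fun n _ => ?_
        unfold latticeConv
        rw [tsum_mul_left]
    _ = ∑' u, ∑ n ∈ Finset.range (M + 1), (-1 : ℝ) ^ n * ((lacePiT d p n u).toReal * g (x - u)) :=
        (Summable.tsum_finsetSum fun n _ => (hsum_eg n).mul_left _).symm
    _ = ∑' u, (lacePiM d p M u * g (x - u) + delta0 u * g (x - u)) :=
        tsum_congr fun u => by rw [hpt u]; ring
    _ = ∑' u, lacePiM d p M u * g (x - u) + ∑' u, delta0 u * g (x - u) := hPiM.tsum_add hδ
    _ = latticeConv (lacePiM d p M) g x + g x := by rw [tsum_delta0_mul]; rfl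

end Real

/-! ### Prop. 6.1 -/

/-- DISCHARGE of the named fact `HvdH2017_prop61` — **Prop. 6.1 (the inclusion–exclusion lace
expansion)** of Heydenreich–van der Hofstad 2017 for bond percolation on `ℤ^d`, `d ≥ 2`, `p < p_c`:
for every `M`, `τ(x) = δ_{0,x} + (J⋆τ)(x) + (Π_M⋆J⋆τ)(x) + Π_M(x) + R_M(x)` with
`Π_M = Σ_{N ≤ M} (-1)^N Π^{(N)}` and `Π^{(N)}`, `R_M` the nested expectations (6.2.7)/(6.2.25)/(6.2.27),
(6.2.20)/(6.2.26)/(6.2.28). Proof: Lemma 6.5 (cutting-bond partition, `…Pivotal.lean`), Lemma 6.4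
(cutting-bond lemma, `…CuttingBond.lean`), (6.2.19), and the induction of Exercise 6.5 carried
out on `[0,∞]`-valued kernels (`nestIter_kerThrough_add`) and telescoped in `ℝ`.
[cite: HeydenreichVanDerHofstad2017, Prop. 6.1 ((6.2.2)–(6.2.3))] [cite: HaraSlade1990, Prop. 2.3] [cite: Slade2006LaceExpansion, Thm. 10.2] -/
theorem HvdH2017_prop61_holds : HvdH2017_prop61 := by
  intro d hd p hp M x
  have halt := toReal_kerThrough_eq_alternating hd hp x M
  have hsum1 : ∑ n ∈ Finset.range (M + 1), (-1 : ℝ) ^ n * (lacePiT d p n x).toReal =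
      lacePiM d p M x + delta0 x := sum_neg_one_pow_mul_lacePiT_toReal p M x
  rw [hsum1, sum_neg_one_pow_mul_latticeConv_lacePiT hd hp M x] at halt
  have ht0 : (nestIter d p (kerThrough d p) 0 Set.univ 0 x).toReal = tau d p 0 x := by
    rw [nestIter_zero, kerThrough_apply, connThrough_univ, tau_def, measureReal_def]
  have hR : (-1 : ℝ) ^ (M + 1) * (nestIter d p (kerThrough d p) (M + 1) Set.univ 0 x).toReal =
      laceR d p M x := (laceR_def p M x).symm
  rw [ht0, hR] at halt
  linear_combination halt

end Literature.Barriers.CriticalPhenomena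

end
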